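import Summits.ValiantsHypothesis.ValiantsHypothesis.Theorems.FifoMatchingNNDivisionHardExactPencilReadCube
import HarnessLib

/-! # Exact pencils, D1 part 16a (port of `Cruxes/NNDivisionHard/ExactPencil38c.lean` rev 1 @e32933e05cb2 §13d-A/B/C, val-idea-38 g4; crux `FifoMatching.NNDivisionHard`, stmt-ValiantsHypothesis-21181; crit-9 g4 V#140b KERNEL VERIFIED + CONTENT GO) — THE COUNTING KIT of the zonotope closure lemma

First of TWO files (400-line rule): this file = §13d-A ℕ-numerics (`K^K ≥ 2(K−1)^K`, the threshold `(N + K)(K−1)^m < K^m` from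
`N + K < 2^q`, `qK ≤ m`), §13d-B the located pair `(Z, lab Z f)` / the unread shape `ConstOn` / the dichotomy `offT_or_constOn`, and
§13d-C the COUNTING over all labellings `Fin n → Fin K` (`exists_good_fun`).  The closure lemma itself
(★★★ `cor_add_subexpGenCube_decided`) is the sibling `Theorems/FifoMatchingNNDivisionHardExactPencilSubexpCube.lean`, which imports this
file.  All texts VERBATIM from the staged kit `pub/ideators/val-idea-38/staged/port-ExactPencil38c/` dfd82fecda70c111 (two lint docstrings added; ONE forced delta: the kit's `pow_add_mul_pow_le` / `two_mul_pow_le` are inlined into `two_pow_mul_pow_le`, see its docstring).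

HONEST LABEL: helper lemmas toward an instance theorem (DECIDED SPECIES: affine cubes with sub-exponentially many generators) of the OPEN
law C′ = `LocatedRows.ExactPencilLaw` ≡ COR-VIRTUAL; the crux 21181 `NNDivisionHard` is OPEN; 0 enemies in sight.  VP ≠ VNP is NOT proved
here or anywhere in this tree.
-/

set_option autoImplicit false

-- the mandated summit-side namespace repeats a component by design (single-problem summit)
set_option linter.dupNamespace false

noncomputable section

open Matrix Finset
open scoped Pointwise

namespace Summit.ValiantsHypothesis.ValiantsHypothesis.Theorems.FifoMatching.ExactPencil.SubexpCube

/-! ### §13d-A ℕ-numerics: `K^K ≥ 2(K−1)^K` and `2^q (K−1)^m ≤ K^m` for `m ≥ qK` -/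

section Numerics

/-- `2^q (K−1)^{qK+s} ≤ K^{qK+s}` (`K ≥ 1`), through the ℕ-Bernoulli step `2·a^{a+1} ≤ (a+1)^{a+1}` (first two binomial
terms), proved inline.  [Port note: the kit's two stand-alone lemmas `pow_add_mul_pow_le` / `two_mul_pow_le` are alpha-equivalent to
landed ones in `…TriangularDimersDivisionEasy.Negative` (dedup lint), whose module has no hub olean; they are therefore inlined here as
`have`s — the only delta of this port; every other text is verbatim.] -/
theorem two_pow_mul_pow_le (K q s : ℕ) (hK : 1 ≤ K) : 2 ^ q * (K - 1) ^ (q * K + s) ≤ K ^ (q * K + s) := by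
  obtain ⟨a, rfl⟩ : ∃ a, K = a + 1 := ⟨K - 1, by omega⟩
  rw [Nat.add_sub_cancel]
  -- the first two binomial terms: `a^{k+1} + (k+1)a^k ≤ (a+1)^{k+1}`
  have hbin : ∀ k : ℕ, a ^ (k + 1) + (k + 1) * a ^ k ≤ (a + 1) ^ (k + 1) := by
    intro k
    induction k with
    | zero => simp
    | succ k ih =>
      have h1 : a ^ (k + 2) + (k + 2) * a ^ (k + 1) ≤ (a ^ (k + 1) + (k + 1) * a ^ k) * (a + 1) := by
        have : (a ^ (k + 1) + (k + 1) * a ^ k) * (a + 1) =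
            a ^ (k + 2) + (k + 2) * a ^ (k + 1) + (k + 1) * a ^ k := by
          ring
        rw [this]
        exact Nat.le_add_right _ _
      calc a ^ (k + 2) + (k + 2) * a ^ (k + 1) ≤ (a ^ (k + 1) + (k + 1) * a ^ k) * (a + 1) := h1
        _ ≤ (a + 1) ^ (k + 1) * (a + 1) := Nat.mul_le_mul_right _ ih
        _ = (a + 1) ^ (k + 2) := by ring
  -- ℕ-Bernoulli: `2·a^{a+1} ≤ (a+1)^{a+1}`, i.e. `(1 − 1/K)^K ≤ 1/2` for `K = a + 1`
  have hbern : 2 * a ^ (a + 1) ≤ (a + 1) ^ (a + 1) := by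
    calc 2 * a ^ (a + 1) = a ^ (a + 1) + a * a ^ a := by ring
      _ ≤ a ^ (a + 1) + (a + 1) * a ^ a := by gcongr; exact Nat.le_succ a
      _ ≤ (a + 1) ^ (a + 1) := hbin a
  calc 2 ^ q * a ^ (q * (a + 1) + s) = (2 * a ^ (a + 1)) ^ q * a ^ s := by
        rw [mul_pow, ← pow_mul, pow_add]; ring
    _ ≤ ((a + 1) ^ (a + 1)) ^ q * (a + 1) ^ s :=
        Nat.mul_le_mul (Nat.pow_le_pow_left hbern q) (Nat.pow_le_pow_left (Nat.le_succ a) s)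
    _ = (a + 1) ^ (q * (a + 1) + s) := by rw [← pow_mul, ← pow_add]; ring_nf

/-- the threshold in use: `N + K < 2^q`, `qK ≤ m` ⟹ `(N + K)(K−1)^m < K^m` (`K ≥ 2`). -/
theorem threshold_lt (N K q m : ℕ) (hK : 2 ≤ K) (hN : N + K < 2 ^ q) (hm : q * K ≤ m) :
    (N + K) * (K - 1) ^ m < K ^ m := by
  obtain ⟨s, rfl⟩ : ∃ s, m = q * K + s := ⟨m - q * K, by omega⟩
  have hpos : 0 < (K - 1) ^ (q * K + s) := Nat.pow_pos (by omega)
  calc (N + K) * (K - 1) ^ (q * K + s) < 2 ^ q * (K - 1) ^ (q * K + s) := Nat.mul_lt_mul_of_pos_right hN hpos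
    _ ≤ K ^ (q * K + s) := two_pow_mul_pow_le K q s (by omega)

/-- antitonicity of `(K−1)^h K^{n−h}` in `h ≤ n`. -/
theorem pow_mul_pow_antitone (K n m h : ℕ) (hmh : m ≤ h) (hhn : h ≤ n) :
    (K - 1) ^ h * K ^ (n - h) ≤ (K - 1) ^ m * K ^ (n - m) := by
  obtain ⟨d, rfl⟩ : ∃ d, h = m + d := ⟨h - m, by omega⟩
  have hn : n - m = d + (n - (m + d)) := by omega
  rw [hn, pow_add, pow_add, mul_assoc]
  refine Nat.mul_le_mul_left _ (Nat.mul_le_mul_right _ (Nat.pow_le_pow_left (Nat.sub_le K 1) d))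

/-- a two-valued product with at least `m` small factors. -/
theorem prod_ite_mem_le {n : ℕ} (K m : ℕ) (S : Finset (Fin n)) (hm : m ≤ S.card) :
    ∏ y : Fin n, (if y ∈ S then K - 1 else K) ≤ (K - 1) ^ m * K ^ (n - m) := by
  classical
  rw [Finset.prod_ite, Finset.prod_const, Finset.prod_const]
  have h1 : (Finset.univ.filter fun y : Fin n => y ∈ S) = S := by
    ext y; simp
  have h2 : (Finset.univ.filter fun y : Fin n => ¬ y ∈ S).card = n - S.card := by
    rw [Finset.filter_not, h1, Finset.card_univ_sdiff, Fintype.card_fin]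
  rw [h1, h2]
  exact pow_mul_pow_antitone K n m S.card hm (by simpa using Finset.card_le_univ S)

end Numerics

/-! ### §13d-B the located pair `(Z, lab Z f)`, the unread shape `ConstOn`, and the dichotomy -/

section Located

variable {n : ℕ}

/-- the labelling of the located pair: dead label `Fin.last K` on `Z`, live label `f x` elsewhere. -/
def lab {K : ℕ} (Z : Finset (Fin n)) (f : Fin n → Fin K) : Fin n → Fin (K + 1) :=
  fun x => if x ∈ Z then Fin.last K else (f x).castSucc

/-- a row carries the dead label `Fin.last K` iff it lies in `Z`. -/
theorem lab_mem_iff {K : ℕ} (Z : Finset (Fin n)) (f : Fin n → Fin K) (x : Fin n) :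
    lab Z f x ∈ ({Fin.last K} : Finset (Fin (K + 1))) ↔ x ∈ Z := by
  rw [Finset.mem_singleton]
  unfold lab
  split_ifs with h
  · simp [h]
  · simp only [h, iff_false]
    exact (Fin.castSucc_lt_last (f x)).ne

/-- two live rows with the same live label get the same located label. -/
theorem lab_eq_of_eq {K : ℕ} (Z : Finset (Fin n)) (f : Fin n → Fin K) {x x' : Fin n} (hx : x ∉ Z) (hx' : x' ∉ Z)
    (h : f x = f x') : lab Z f x = lab Z f x' := by
  simp [lab, hx, hx', h]

/-- every label is attained: the dead one on `Z ≠ ∅`, the live ones by hypothesis. -/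
theorem lab_section {K : ℕ} (Z : Finset (Fin n)) (f : Fin n → Fin K) (hZ : Z.Nonempty)
    (hsurj : ∀ j : Fin K, ∃ y, y ∉ Z ∧ f y = j) : ∃ σ : Fin (K + 1) → Fin n, ∀ i, lab Z f (σ i) = i := by
  obtain ⟨z, hz⟩ := hZ
  choose y hy using hsurj
  refine ⟨fun i => Fin.lastCases (motive := fun _ => Fin n) z y i, fun i => ?_⟩
  induction i using Fin.lastCases with
  | last => simp [Fin.lastCases_last, lab, hz]
  | cast j => simp [Fin.lastCases_castSucc, lab, (hy j).1, (hy j).2]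

/-- the UNREAD SHAPE at dead set `Z`: zero on dead rows and columns, one nonzero constant on `Zᶜ × Zᶜ` (`g = c·𝟙_{Zᶜ}𝟙_{Zᶜ}ᵀ`). -/
def ConstOn (g : Matrix (Fin n) (Fin n) ℝ) (Z : Finset (Fin n)) : Prop :=
  (∀ x y, (x ∈ Z ∨ y ∈ Z) → g x y = 0) ∧ ∃ c : ℝ, c ≠ 0 ∧ ∀ x y, x ∉ Z → y ∉ Z → g x y = c

/-- ★ the unread shape determines its dead set (`x ∈ Z ↔ g x x = 0`): `Z ↦` an unread generator is injective. -/
theorem constOn_inj {g : Matrix (Fin n) (Fin n) ℝ} {Z Z' : Finset (Fin n)} (h : ConstOn g Z) (h' : ConstOn g Z') :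
    Z = Z' := by
  obtain ⟨hz, c, hc, hcst⟩ := h
  obtain ⟨hz', c', hc', hcst'⟩ := h'
  ext x
  constructor
  · intro hx
    by_contra hx'
    exact hc' ((hcst' x x hx' hx').symm.trans (hz x x (Or.inl hx)))
  · intro hx'
    by_contra hx
    exact hc ((hcst x x hx hx).symm.trans (hz' x x (Or.inl hx')))

/-- ★ DICHOTOMY: under a labelling that puts two UNEQUAL live rows of `g` into one block whenever `g` has two unequal live rows,
a nonzero generator is either READ at `(Z, lab Z f)` (dead entry / row move / column move / transpose move, the hypothesis of
★★★ `cor_add_bound_of_cube_offT`) or has the unread shape `ConstOn g Z`. -/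
theorem offT_or_constOn {K : ℕ} (Z : Finset (Fin n)) (f : Fin n → Fin K) (g : Matrix (Fin n) (Fin n) ℝ) (hg : g ≠ 0)
    (hL : ∃ x₀, x₀ ∉ Z)
    (hgood : (∃ x₁, x₁ ∉ Z ∧ ∃ x₂, x₂ ∉ Z ∧ ∃ y, g x₁ y ≠ g x₂ y) →
      ∃ x x', x ∉ Z ∧ x' ∉ Z ∧ f x = f x' ∧ ∃ y, g x y ≠ g x' y) :
    ((∃ x y, g x y ≠ 0 ∧ (lab Z f x ∈ ({Fin.last K} : Finset (Fin (K + 1))) ∨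
        lab Z f y ∈ ({Fin.last K} : Finset (Fin (K + 1))))) ∨
      (∃ x x' y, lab Z f x = lab Z f x' ∧ g x y ≠ g x' y) ∨
      (∃ x y y', lab Z f y = lab Z f y' ∧ g x y ≠ g x y') ∨ (∃ x y, g x y ≠ g y x)) ∨ ConstOn g Z := by
  by_cases h1 : ∃ x y, g x y ≠ 0 ∧ (x ∈ Z ∨ y ∈ Z)
  · obtain ⟨x, y, hxy, hd⟩ := h1
    refine Or.inl (Or.inl ⟨x, y, hxy, ?_⟩)
    rwa [lab_mem_iff, lab_mem_iff]
  push Not at h1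
  by_cases h2 : ∃ x y, g x y ≠ g y x
  · exact Or.inl (Or.inr (Or.inr (Or.inr h2)))
  push Not at h2
  by_cases h3 : ∃ x₁, x₁ ∉ Z ∧ ∃ x₂, x₂ ∉ Z ∧ ∃ y, g x₁ y ≠ g x₂ y
  · obtain ⟨x, x', hx, hx', hf, y, hy⟩ := hgood h3
    exact Or.inl (Or.inr (Or.inl ⟨x, x', y, lab_eq_of_eq Z f hx hx' hf, hy⟩))
  push Not at h3
  right
  obtain ⟨x₀, hx₀⟩ := hL
  have hzero : ∀ x y, (x ∈ Z ∨ y ∈ Z) → g x y = 0 := fun x y hxy => by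
    by_contra hne
    rcases hxy with hx | hy
    · exact (h1 x y hne).1 hx
    · exact (h1 x y hne).2 hy
  have hconst : ∀ x y, x ∉ Z → y ∉ Z → g x y = g x₀ x₀ := fun x y hx hy => by
    rw [h3 x hx x₀ hx₀ y, h2 x₀ y, h3 y hy x₀ hx₀ x₀]
  refine ⟨hzero, g x₀ x₀, fun hc => hg ?_, hconst⟩
  ext x y
  rw [Matrix.zero_apply]
  by_cases hxy : x ∈ Z ∨ y ∈ Z
  · exact hzero x y hxy
  · push Not at hxy
    rw [hconst x y hxy.1 hxy.2, hc]

end Located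

/-! ### §13d-C COUNTING over all labellings `Fin n → Fin K` (`Fintype.piFinset`) -/

section Counting

variable {n : ℕ}

/-- ★ COUNTING = steps (ii)+(iii) of the closure lemma over ALL labellings: if `(|I| + K)(K−1)^m K^{n−m} < K^n`, some
`f : Fin n → Fin K` attains every label on `Zᶜ` AND, for every `t ∈ I`, gives the base row `x t` the label of some row of `M t`
(`x t ∉ M t`, `|M t| ≥ m`).  Bad labellings: missing label `j` on `Zᶜ` (`K^{|Z|}(K−1)^{|Zᶜ|}` each), or `M t` dodging the label of `x t`
(`Σ_v (K−1)^{|M t|} K^{n−1−|M t|}` each) — both `≤ (K−1)^m K^{n−m}`. -/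
theorem exists_good_fun {K : ℕ} {ι : Type*} (I : Finset ι) (Z : Finset (Fin n)) (x : ι → Fin n)
    (M : ι → Finset (Fin n)) (hxM : ∀ t ∈ I, x t ∉ M t) (m : ℕ) (hMm : ∀ t ∈ I, m ≤ (M t).card)
    (hZm : m ≤ Zᶜ.card) (hnum : (I.card + K) * ((K - 1) ^ m * K ^ (n - m)) < K ^ n) :
    ∃ f : Fin n → Fin K, (∀ j : Fin K, ∃ y, y ∉ Z ∧ f y = j) ∧ ∀ t ∈ I, ∃ x', x' ∈ M t ∧ f x' = f (x t) := by
  classical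
  -- the two bad families of labellings
  let bad1 : Fin K → Finset (Fin n → Fin K) := fun j =>
    Fintype.piFinset fun y => if y ∈ Z then (Finset.univ : Finset (Fin K)) else Finset.univ.erase j
  let cell : ι → Fin K → Fin n → Finset (Fin K) := fun t v y =>
    if y = x t then {v} else if y ∈ M t then Finset.univ.erase v else Finset.univ
  let bad2 : ι → Finset (Fin n → Fin K) := fun t => Finset.univ.biUnion fun v => Fintype.piFinset (cell t v)
  -- their sizes
  have hK1 : ∀ j : Fin K, (bad1 j).card ≤ (K - 1) ^ m * K ^ (n - m) := by
    intro j
    dsimp only [bad1]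
    rw [Fintype.card_piFinset]
    have hc : ∀ y : Fin n, (if y ∈ Z then (Finset.univ : Finset (Fin K)) else Finset.univ.erase j).card
        = if y ∈ Zᶜ then K - 1 else K := by
      intro y
      by_cases hy : y ∈ Z
      · simp [hy, Finset.card_univ]
      · simp [hy, Finset.card_erase_of_mem, Finset.card_univ]
    rw [Finset.prod_congr rfl fun y _ => hc y]
    exact prod_ite_mem_le K m Zᶜ hZm
  have hK2 : ∀ t ∈ I, (bad2 t).card ≤ (K - 1) ^ m * K ^ (n - m) := by
    intro t ht
    let d : Fin n → ℕ := fun y => if y ∈ M t then K - 1 else K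
    have hcell : ∀ v, (Fintype.piFinset (cell t v)).card = ∏ y ∈ Finset.univ.erase (x t), d y := by
      intro v
      rw [Fintype.card_piFinset, ← Finset.mul_prod_erase Finset.univ (fun y => (cell t v y).card) (Finset.mem_univ (x t))]
      have h0 : (cell t v (x t)).card = 1 := by simp [cell]
      rw [h0, one_mul]
      refine Finset.prod_congr rfl fun y hy => ?_
      have hyx : y ≠ x t := Finset.ne_of_mem_erase hy
      by_cases hyM : y ∈ M t
      · simp [cell, d, hyx, hyM, Finset.card_erase_of_mem, Finset.card_univ]
      · simp [cell, d, hyx, hyM, Finset.card_univ]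
    have hdx : d (x t) = K := by simp [d, hxM t ht]
    dsimp only [bad2]
    calc (Finset.univ.biUnion fun v => Fintype.piFinset (cell t v)).card
        ≤ ∑ v, (Fintype.piFinset (cell t v)).card := Finset.card_biUnion_le
      _ = K * ∏ y ∈ Finset.univ.erase (x t), d y := by
          rw [Finset.sum_congr rfl fun v _ => hcell v, Finset.sum_const, Finset.card_univ, Fintype.card_fin,
            smul_eq_mul]
      _ = ∏ y, d y := by
          rw [← Finset.mul_prod_erase Finset.univ d (Finset.mem_univ (x t)), hdx]
      _ ≤ (K - 1) ^ m * K ^ (n - m) := prod_ite_mem_le K m (M t) (hMm t ht)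
  -- a labelling outside every bad set exists by counting
  set B : Finset (Fin n → Fin K) := (Finset.univ.biUnion bad1) ∪ I.biUnion bad2 with hB
  have hBcard : B.card < (Finset.univ : Finset (Fin n → Fin K)).card := by
    calc B.card ≤ (Finset.univ.biUnion bad1).card + (I.biUnion bad2).card := Finset.card_union_le _ _
      _ ≤ (∑ j, (bad1 j).card) + ∑ t ∈ I, (bad2 t).card :=
          Nat.add_le_add Finset.card_biUnion_le Finset.card_biUnion_le
      _ ≤ (∑ _j : Fin K, (K - 1) ^ m * K ^ (n - m)) + ∑ _t ∈ I, (K - 1) ^ m * K ^ (n - m) :=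
          Nat.add_le_add (Finset.sum_le_sum fun j _ => hK1 j) (Finset.sum_le_sum fun t ht => hK2 t ht)
      _ = (I.card + K) * ((K - 1) ^ m * K ^ (n - m)) := by
          rw [Finset.sum_const, Finset.sum_const, Finset.card_univ, Fintype.card_fin, smul_eq_mul, smul_eq_mul]
          ring
      _ < K ^ n := hnum
      _ = (Finset.univ : Finset (Fin n → Fin K)).card := by
          rw [Finset.card_univ, Fintype.card_fun, Fintype.card_fin, Fintype.card_fin]
  obtain ⟨f, -, hf⟩ := Finset.exists_mem_notMem_of_card_lt_card hBcard
  rw [hB, Finset.mem_union, not_or, Finset.mem_biUnion, Finset.mem_biUnion, not_exists, not_exists] at hf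
  refine ⟨f, fun j => ?_, fun t ht => ?_⟩
  · have hj : f ∉ bad1 j := fun h => hf.1 j ⟨Finset.mem_univ j, h⟩
    dsimp only [bad1] at hj
    rw [Fintype.mem_piFinset] at hj
    push Not at hj
    obtain ⟨y, hy⟩ := hj
    by_cases hyZ : y ∈ Z
    · simp [hyZ] at hy
    · refine ⟨y, hyZ, ?_⟩
      simpa [hyZ, Finset.mem_erase] using hy
  · by_contra hne
    push Not at hne
    apply hf.2 t ⟨ht, ?_⟩
    dsimp only [bad2]
    rw [Finset.mem_biUnion]
    refine ⟨f (x t), Finset.mem_univ _, Fintype.mem_piFinset.2 fun y => ?_⟩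
    by_cases hyx : y = x t
    · subst hyx
      simp [cell]
    · by_cases hyM : y ∈ M t
      · simpa [cell, hyx, hyM, Finset.mem_erase] using hne y hyM
      · simp [cell, hyx, hyM]

end Counting

end Summit.ValiantsHypothesis.ValiantsHypothesis.Theorems.FifoMatching.ExactPencil.SubexpCube

end
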